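import Mathlib
import Summits.NavierStokesRegularity.NavierStokesRegularity.Theorems.EulerZoomLiouvillePowerGaugeEulerLiouvilleSelfSimilarKelvin
import Literature.Analysis.FluidPDE.KelvinCirculationProofs
import Literature.Analysis.FluidPDE.TrajectoryJacobianLiouville
import Literature.Analysis.FluidPDE.TrajectoryGradientBound
import HarnessLib.Audit

/-!
# Crux `EulerZoomLiouville.PowerGaugeEulerLiouville`: KELVIN'S CIRCULATION THEOREM, TORUS-AVERAGED,
# for classical Euler flows in physical variables (the lever of the endpoint concentration strata)

Route №10 `EulerZoomLiouville` (NavierStokesRegularity), crux E = stmt-NavierStokesRegularity-19832,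
registered residues `stub_selfSimilarExtremal` / `stub_nonSelfSimilar` (skeleton v9/v10, line
`birth`).  The self-similar files (`…SelfSimilarKelvin*`) ran Kelvin's theorem along the flow of
`γy + V` in profile variables; here is the PHYSICAL-VARIABLE form, valid for every classical Euler
flow (self-similar or not) — the lever for the classical energy-concentrating members of
`stub_nonSelfSimilar` (⊇ discretely self-similar ones) in the sequel `…KelvinPhysicalFarField`.

Setting: `(u, p)` a classical Euler solution on a convex OPEN time set `S`
(`IsClassicalEulerSolutionOn S 0 u p`) whose velocity satisfies the Cauchy–Lipschitz hypotheses
(`ODE.IsUniformlyLipschitzOn u S`, e.g. bounded gradient on compact sub-slabs); `X = φ(·, t₀, ·) =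
ODE.evolutionMap u t₀` the particle-trajectory map from the time `t₀ ∈ S`.

* `det_fderiv_evolutionMap_eq_one_of_mem` — incompressibility: `det DX_t(a) = 1` (two-time form);
* `setIntegral_norm_comp_evolutionMap` — `∫_A ‖u(t, X_t a)‖ da = ∫_{X_t A} ‖u(t, x)‖ dx`,
  `vol(X_t A) = vol A`;
* `integral_inner_evolutionMap_eq` — **KELVIN, TORUS-AVERAGED**: for every smooth compactly
  supported divergence-free `B` and all `t₀, t ∈ S`,
  `∫ ⟪u(t, X_t a), DX_t(a) B(a)⟫ da = ∫ ⟪u(t₀, a), B(a)⟫ da`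
  (the tree's `IsClassicalEulerSolutionOn.hasDerivAt_circulation_integrand` gives
  `d/dt ⟪u(t,X), DX b⟫ = D(½|u|² − p)(X)[DX b]`; integrate in `a`, differentiate under the integral
  on the compact support, and `∫ D(G∘X_t)[B] = −∫ (G∘X_t) div B = 0`).

WHAT THIS IS NOT: not NS, not E — an identity for CLASSICAL flows; it constrains nothing by itself.

## References

* A. J. Majda, A. L. Bertozzi, *Vorticity and Incompressible Flow*, CUP 2002, §1.6 Props. 1.10–1.11
  (Kelvin's circulation theorem), §1.3 (particle trajectories). [MajdaBertozziCUP2002]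
* P. Constantin, M. Ignatova, V. Vicol, arXiv:2602.17570 (2026), §3.4.1 (Weber formula).
  [ConstantinIgnatovaVicol2026Putative]
-/

noncomputable section

-- flat `Theorems/<Route><Decl>…` files of one crux share the namespace of the crux (tree convention)
set_option linter.dupNamespace false

open MeasureTheory Set Filter Topology Metric Function InnerProductSpace
open scoped RealInnerProductSpace NNReal ENNReal ContDiff

namespace Summit.NavierStokesRegularity.NavierStokesRegularity.Theorems.PowerGaugeEulerLiouville.KelvinPhysical

open Literature.Analysis Literature.Analysis.FluidPDE

variable {S : Set ℝ} {u : ℝ → EuclideanSpace ℝ (Fin 3) → EuclideanSpace ℝ (Fin 3)}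
  {p : ℝ → EuclideanSpace ℝ (Fin 3) → ℝ} {t₀ t : ℝ}

/-! ### Incompressibility of the particle-trajectory maps (two-time form) -/

/-- **`det DX_t(a) = 1`** for the two-time maps `X_t = φ(t, t₀, ·)` of a classical Euler flow
(`div u = 0` in Liouville's formula). [cite: MajdaBertozziCUP2002, §1.3 Prop. 1.4 (ii) ⇒ (iii); §2.5 p. 71] -/
theorem det_fderiv_evolutionMap_eq_one_of_mem (h : IsClassicalEulerSolutionOn S 0 u p)
    (hL : ODE.IsUniformlyLipschitzOn u S) (hS : Convex ℝ S) (hU : UniqueDiffOn ℝ S) (ht₀ : t₀ ∈ S)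
    (ht : t ∈ S) (a : EuclideanSpace ℝ (Fin 3)) :
    (fderiv ℝ (ODE.evolutionMap u t₀ t) a).det = 1 := by
  rw [det_fderiv_evolutionMap_eq_exp_integral_divergence_of_mem hL h.smooth_velocity hS hU ht₀ ht a]
  have hsub := hS.ordConnected.uIcc_subset ht₀ ht
  have h0 : ∀ s ∈ uIcc t₀ t, VectorCalculus.divergence (u s) (ODE.evolutionMap u t₀ s a) = 0 :=
    fun s hs => h.divFree s (hsub hs) _
  rw [intervalIntegral.integral_congr (g := fun _ => (0 : ℝ)) h0]
  simp

/-- **Volume preservation of the two-time maps**: `vol(X_t A) = vol A` for measurable `A`.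
[cite: MajdaBertozziCUP2002, §1.3 Def. 1.1, Prop. 1.4] -/
theorem volume_image_evolutionMap (h : IsClassicalEulerSolutionOn S 0 u p)
    (hL : ODE.IsUniformlyLipschitzOn u S) (hS : Convex ℝ S) (hU : UniqueDiffOn ℝ S) (ht₀ : t₀ ∈ S)
    (ht : t ∈ S) {A : Set (EuclideanSpace ℝ (Fin 3))} (hAm : MeasurableSet A) :
    volume (ODE.evolutionMap u t₀ t '' A) = volume A := by
  have hdiff : ∀ x ∈ A, HasFDerivWithinAt (ODE.evolutionMap u t₀ t)
      (fderiv ℝ (ODE.evolutionMap u t₀ t) x) A x := fun x _ =>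
    (((hL.contDiff_evolutionMap hS hU le_top h.smooth_velocity ht₀ ht).differentiable (by simp))
      x).hasFDerivAt.hasFDerivWithinAt
  have hinj : InjOn (ODE.evolutionMap u t₀ t) A :=
    (hL.bijective_evolutionMap hS ht₀ ht).injective.injOn
  rw [← lintegral_abs_det_fderiv_eq_addHaar_image volume hAm hdiff hinj]
  simp_rw [det_fderiv_evolutionMap_eq_one_of_mem h hL hS hU ht₀ ht]
  simp

/-- **Transport of an `L¹` quantity by the volume-preserving maps**:
`∫_{X_t A} g = ∫_A g ∘ X_t` for measurable `A`. [cite: MajdaBertozziCUP2002, §1.3 proof of Prop. 1.3 (change of variables)] -/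
theorem setIntegral_image_evolutionMap (h : IsClassicalEulerSolutionOn S 0 u p)
    (hL : ODE.IsUniformlyLipschitzOn u S) (hS : Convex ℝ S) (hU : UniqueDiffOn ℝ S) (ht₀ : t₀ ∈ S)
    (ht : t ∈ S) {A : Set (EuclideanSpace ℝ (Fin 3))} (hAm : MeasurableSet A) (g : EuclideanSpace ℝ (Fin 3) → ℝ) :
    ∫ x in ODE.evolutionMap u t₀ t '' A, g x = ∫ a in A, g (ODE.evolutionMap u t₀ t a) := by
  have hdiff : ∀ x ∈ A, HasFDerivWithinAt (ODE.evolutionMap u t₀ t)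
      (fderiv ℝ (ODE.evolutionMap u t₀ t) x) A x := fun x _ =>
    (((hL.contDiff_evolutionMap hS hU le_top h.smooth_velocity ht₀ ht).differentiable (by simp))
      x).hasFDerivAt.hasFDerivWithinAt
  have hinj : InjOn (ODE.evolutionMap u t₀ t) A :=
    (hL.bijective_evolutionMap hS ht₀ ht).injective.injOn
  rw [integral_image_eq_integral_abs_det_fderiv_smul volume hAm hdiff hinj]
  refine setIntegral_congr_fun hAm fun a _ => ?_
  rw [det_fderiv_evolutionMap_eq_one_of_mem h hL hS hU ht₀ ht a]
  simp

/-! ### Kelvin's theorem, torus-averaged -/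

/-- **Kelvin's circulation theorem paired against a divergence-free test field.** For a classical
Euler flow on a convex open time set `S` with the Cauchy–Lipschitz hypotheses, `t₀, t ∈ S`, and
`B ∈ C_c^∞` divergence-free:
`∫ ⟪u(t, X_t a), DX_t(a) B(a)⟫ da = ∫ ⟪u(t₀, a), B(a)⟫ da`, `X_t = φ(t, t₀, ·)`
(Majda–Bertozzi Prop. 1.11 for the family of loops of the flux tube of `B`).
[cite: MajdaBertozziCUP2002, §1.6 Props. 1.10–1.11, eqs. (1.58)–(1.59)] -/
theorem integral_inner_evolutionMap_eq (h : IsClassicalEulerSolutionOn S 0 u p)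
    (hL : ODE.IsUniformlyLipschitzOn u S) (hS : Convex ℝ S) (hSo : IsOpen S) (ht₀ : t₀ ∈ S)
    (ht : t ∈ S) {B : EuclideanSpace ℝ (Fin 3) → EuclideanSpace ℝ (Fin 3)} (hB : ContDiff ℝ ∞ B)
    (hBc : HasCompactSupport B) (hBdiv : VectorCalculus.IsDivFree B) :
    ∫ a, ⟪u t (ODE.evolutionMap u t₀ t a), fderiv ℝ (ODE.evolutionMap u t₀ t) a (B a)⟫ =
      ∫ a, ⟪u t₀ a, B a⟫ := by
  have hU : UniqueDiffOn ℝ S := hSo.uniqueDiffOn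
  set X := ODE.evolutionMap u t₀ with hX
  have hXs : IsSmoothSpaceTimeOn S X := isSmoothSpaceTimeOn_evolutionMap hL h.smooth_velocity hS hU ht₀
  have hXu : ∀ r ∈ S, ∀ a, HasDerivWithinAt (fun s => X s a) (u r (X r a)) S r := fun r hr a =>
    hL.hasDerivWithinAt_evolutionMap hS ht₀ hr a
  -- the integrand `F(r, a) = ⟪u(r, X_r a), DX_r(a) B(a)⟫` is jointly smooth on `S × ℝ³`
  set F : ℝ → EuclideanSpace ℝ (Fin 3) → ℝ := fun r a => ⟪u r (X r a), fderiv ℝ (X r) a (B a)⟫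
    with hF
  have huX : IsSmoothSpaceTimeOn S (fun r a => u r (X r a)) := by
    have hΨ : ContDiffOn ℝ ∞ (fun z : ℝ × EuclideanSpace ℝ (Fin 3) => ((z.1, X z.1 z.2) : ℝ × _))
        (S ×ˢ univ) := contDiffOn_fst.prodMk hXs
    have hmaps : MapsTo (fun z : ℝ × EuclideanSpace ℝ (Fin 3) => ((z.1, X z.1 z.2) : ℝ × _))
        (S ×ˢ (univ : Set (EuclideanSpace ℝ (Fin 3)))) (S ×ˢ univ) := fun z hz =>
      mk_mem_prod hz.1 (mem_univ _)
    exact h.smooth_velocity.comp hΨ hmaps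
  have hBs : IsSmoothSpaceTimeOn S (fun _ : ℝ => B) := (hB.comp contDiff_snd).contDiffOn
  have hFs : IsSmoothSpaceTimeOn S F := huX.inner ((hXs.fderiv_slice hU).clm_apply hBs)
  have hF1 : ContDiffOn ℝ 1 (uncurry F) (S ×ˢ univ) := hFs.of_le (mod_cast le_top)
  have hsupp : ∀ r ∈ S, ∀ a ∉ tsupport B, F r a = 0 := by
    intro r _ a ha
    simp [hF, image_eq_zero_of_notMem_tsupport ha]
  -- the derivative of `r ↦ ∫ F r` vanishes on `S`
  have hderiv : ∀ r ∈ S, HasDerivAt (fun r => ∫ a, F r a) 0 r := by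
    intro r hr
    have hd := hasDerivAt_integral_of_contDiffOn (μ := volume) hSo hF1 hBc.isCompact hsupp hr
    have hG1 : ContDiff ℝ 1 (fun z => (1 / 2 : ℝ) * ‖u r z‖ ^ 2 - p r z) :=
      (((h.contDiff_velocity hr).of_le (mod_cast le_top)).norm_sq ℝ |>.const_smul (1 / 2 : ℝ)).sub
        ((h.contDiff_pressure hr).of_le (mod_cast le_top))
    have hline : ∀ a, deriv (fun r => F r a) r =
        fderiv ℝ (fun a => (1 / 2 : ℝ) * ‖u r (X r a)‖ ^ 2 - p r (X r a)) a (B a) := by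
      intro a
      rw [(h.hasDerivAt_circulation_integrand hXs hXu (hSo.mem_nhds hr) a (B a)).deriv]
      have hc : (fun a => (1 / 2 : ℝ) * ‖u r (X r a)‖ ^ 2 - p r (X r a)) =
          (fun z => (1 / 2 : ℝ) * ‖u r z‖ ^ 2 - p r z) ∘ X r := rfl
      rw [hc, fderiv_comp a ((hG1.differentiable one_ne_zero) _)
        (((hXs.contDiff_slice hr).differentiable (by simp)) a)]
      have hG : HasFDerivAt (fun z => (1 / 2 : ℝ) * ‖u r z‖ ^ 2 - p r z)
          ((1 / 2 : ℝ) • ((innerSL ℝ (u r (X r a))).comp (fderiv ℝ (u r) (X r a)) +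
              (innerSL ℝ (u r (X r a))).comp (fderiv ℝ (u r) (X r a))) - fderiv ℝ (p r) (X r a))
          (X r a) := by
        have h1 := (((h.contDiff_velocity hr).differentiable (by simp)) (X r a)).hasFDerivAt.norm_sq
        rw [two_smul] at h1
        exact (h1.const_mul (1 / 2 : ℝ)).sub
          (((h.contDiff_pressure hr).differentiable (by simp)) (X r a)).hasFDerivAt
      rw [ContinuousLinearMap.comp_apply, hG.fderiv]
      simp only [_root_.sub_apply, _root_.smul_apply, _root_.add_apply,
        ContinuousLinearMap.coe_comp, Function.comp_apply, innerSL_apply_apply, smul_eq_mul]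
      ring
    simp_rw [hline] at hd
    have hθ : ContDiff ℝ 1 (fun a => (1 / 2 : ℝ) * ‖u r (X r a)‖ ^ 2 - p r (X r a)) :=
      hG1.comp ((hXs.contDiff_slice hr).of_le (mod_cast le_top))
    rwa [Kelvin.integral_fderiv_apply_eq_zero_of_isDivFree hθ (hB.of_le (mod_cast le_top)) hBc
      hBdiv] at hd
  -- hence `r ↦ ∫ F r` is constant between `t₀` and `t`
  have hsub := hS.ordConnected.uIcc_subset ht₀ ht
  have hconst : ∀ r ∈ uIcc t₀ t, (∫ a, F r a) = ∫ a, F (min t₀ t) a := by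
    intro r hr
    refine constant_of_has_deriv_right_zero (f := fun r => ∫ a, F r a) (a := min t₀ t)
      (b := max t₀ t) ?_ ?_ r hr
    · exact fun r hr => (hderiv r (hsub hr)).continuousAt.continuousWithinAt
    · exact fun r hr => (hderiv r (hsub (Ico_subset_Icc_self hr))).hasDerivWithinAt
  have h0 : (∫ a, F t₀ a) = ∫ a, ⟪u t₀ a, B a⟫ := by
    refine integral_congr_ae (Eventually.of_forall fun a => ?_)
    simp [hF, hX, ODE.evolutionMap_self, fderiv_evolutionMap_self]
  rw [← h0, hconst t right_mem_uIcc, hconst t₀ left_mem_uIcc]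

end Summit.NavierStokesRegularity.NavierStokesRegularity.Theorems.PowerGaugeEulerLiouville.KelvinPhysical

end
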